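import Literature.Analysis.FunctionSpaces.NuclearSpace
import Literature.Analysis.FunctionSpaces.NuclearDominated
import Literature.Analysis.FunctionSpaces.SchwartzNuclear
import HarnessLib

/-!
# The Schwartz space is nuclear: proofs

Discharge of the named fact `Literature.Analysis.FunctionSpaces.nuclearSpace_schwartzMap` of
`Literature/Analysis/FunctionSpaces/NuclearSpace.lean`:

* `Literature.nuclearSpace_schwartzMap_holds : nuclearSpace_schwartzMap E F` — for finite-dimensional
  real normed spaces `E`, `F` the Schwartz space `𝓢(E, F)` is nuclear in Pietsch's seminorm form
  (`Literature.NuclearSpace ℝ`, Pietsch 1972, Prop. 4.1.4). Grothendieck 1955, Ch. II §2 no. 3;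
  Pietsch 1972, 6.2.5; Trèves 1967, Thm 51.5; Gel'fand–Vilenkin IV, Ch. I §3.6.

(Separability of `𝓢(E, F)` would follow from nuclearity by
`Literature.Analysis.FunctionSpaces.NuclearSpace.separableSpace_of_withSeminorms` — Pietsch 1972, Thm. 4.4.10 — but the named
fact `Literature.Analysis.FunctionSpaces.separableSpace_schwartzMap` is already discharged, by a direct second-countability
argument, in `Literature/Analysis/FunctionSpaces/NuclearSpaceSchwartzSeparableProofs.lean`
(`Literature.Analysis.FunctionSpaces.separableSpace_schwartzMap_holds`), which this file does not duplicate.)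

## Proof

1. `𝓢(ℝ^ι, ℂ)` (`ℝ^ι = EuclideanSpace ℝ ι`) as a real locally convex space: by
   `SchwartzNuclear.exists_nuclear_dominating_seminorm_zero` every order-zero Schwartz seminorm
   `p_{k,0}` is nuclearly dominated (`Literature.Analysis.FunctionSpaces.IsNuclearlyDominated`, `NuclearDominated`); by
   `SchwartzNuclear.seminorm_le_sum_seminorm_iteratedLineDeriv`,
   `p_{k,n} ≤ ∑_J p_{k,0} ∘ ∂^{e_J}` with the continuous linear maps `∂^{e_J}`
   (`LineDeriv.iteratedLineDerivOpCLM`), so every `p_{k,n}` is nuclearly dominated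
   (`IsNuclearlyDominated.comp`, `finset_sum`, `mono`), and the Schwartz seminorms generate the
   topology (`schwartz_withSeminorms`), whence `NuclearSpace ℝ 𝓢(ℝ^ι, ℂ)`
   (`IsNuclearlyDominated.nuclearSpace_of_withSeminorms`; Pietsch 1972, Prop. 4.1.4 "some,
   resp. each, fundamental system").
2. `𝓢(D, F)` is a finite retract of `𝓢(D, ℂ)` for finite-dimensional `F`: with a basis `bᵢ` and
   its coordinates `bᵢ*`, `f = ∑ᵢ Re(bᵢ*(f) : ℂ) • bᵢ` through the continuous linear maps
   `SchwartzMap.postcompCLM` (`NuclearSpace.of_finite_retracts`; Pietsch 1972, Props. 5.1.1,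
   5.2.1), and `𝓢(E, F) ≅ 𝓢(ℝ^{dim E}, F)` along `toEuclidean`
   (`SchwartzMap.compCLMOfContinuousLinearEquiv`, `NuclearSpace.of_retract`).
## References

* A. Grothendieck, *Produits tensoriels topologiques et espaces nucléaires*, Mem. AMS 16 (1955),
  Ch. II §2 no. 3.
* A. Pietsch, *Nuclear locally convex spaces*, Ergebnisse 66, Springer (1972), Prop. 4.1.4,
  Thm. 4.4.10, Prop. 5.1.1, Prop. 5.2.1, 6.2.5.
* F. Trèves, *Topological vector spaces, distributions and kernels* (1967), Thm 51.5.
* I. M. Gel'fand, N. Ya. Vilenkin, *Generalized Functions IV* (1964), Ch. I §3.6.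
-/

open scoped SchwartzMap NNReal Topology LineDeriv
open TopologicalSpace

noncomputable section

namespace Literature.Analysis.FunctionSpaces

namespace SchwartzNuclear

section Euclidean

variable {ι : Type*} [Fintype ι] [DecidableEq ι]

omit [DecidableEq ι] in
/-- The order-zero Schwartz seminorms `p_{k,0}` of `𝓢(ℝ^ι, ℂ)` are nuclearly dominated
(`exists_nuclear_dominating_seminorm_zero`, reindexed by `ℕ`). Pietsch 1972, Prop. 4.1.4 with
6.2.5. [cite: Pietsch1972, Prop. 4.1.4 and 6.2.5] -/
theorem isNuclearlyDominated_seminorm_zero (k : ℕ) :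
    IsNuclearlyDominated (SchwartzMap.seminorm ℝ k 0 : Seminorm ℝ 𝓢(EuclideanSpace ℝ ι, ℂ)) := by
  obtain ⟨q, hq, φ, c, hc, hφ, hp⟩ := exists_nuclear_dominating_seminorm_zero (ι := ι) k
  exact IsNuclearlyDominated.of_countable hq φ c hc hφ hp

/-- Every Schwartz seminorm `p_{k,n}` of `𝓢(ℝ^ι, ℂ)` is nuclearly dominated:
`p_{k,n} ≤ ∑_J p_{k,0} ∘ ∂^{e_J}` (`seminorm_le_sum_seminorm_iteratedLineDeriv`) with `∂^{e_J}`
continuous linear. Pietsch 1972, Prop. 4.1.4 with 6.2.5. [cite: Pietsch1972, Prop. 4.1.4 and 6.2.5] -/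
theorem isNuclearlyDominated_seminorm (k n : ℕ) :
    IsNuclearlyDominated (SchwartzMap.seminorm ℝ k n : Seminorm ℝ 𝓢(EuclideanSpace ℝ ι, ℂ)) := by
  set P : (Fin n → ι) → Seminorm ℝ 𝓢(EuclideanSpace ℝ ι, ℂ) := fun J =>
    (SchwartzMap.seminorm ℝ k 0 : Seminorm ℝ 𝓢(EuclideanSpace ℝ ι, ℂ)).comp
      (LineDeriv.iteratedLineDerivOpCLM ℝ 𝓢(EuclideanSpace ℝ ι, ℂ)
        (fun j => EuclideanSpace.single (J j) (1 : ℝ))).toLinearMap with hP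
  have h : IsNuclearlyDominated (∑ J : Fin n → ι, P J) :=
    IsNuclearlyDominated.finset_sum _ fun J _ => (isNuclearlyDominated_seminorm_zero k).comp _
  refine h.mono fun f => ?_
  rw [sum_apply]
  refine (seminorm_le_sum_seminorm_iteratedLineDeriv k n f).trans (le_of_eq ?_)
  refine Finset.sum_congr rfl fun J _ => ?_
  simp only [hP, Seminorm.comp_apply, ContinuousLinearMap.coe_coe,
    LineDeriv.iteratedLineDerivOpCLM_apply]

/-- **The Schwartz space `𝓢(ℝ^ι, ℂ)` is nuclear** (as a real locally convex space, in Pietsch's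
seminorm form): the generating Schwartz seminorms are nuclearly dominated. Grothendieck 1955,
Ch. II §2 no. 3; Pietsch 1972, 6.2.5; Trèves 1967, Thm 51.5. [cite: Pietsch1972, 6.2.5]
[cite: Grothendieck1955, Ch. II §2 no. 3] -/
theorem nuclearSpace_euclidean_complex : NuclearSpace ℝ 𝓢(EuclideanSpace ℝ ι, ℂ) :=
  IsNuclearlyDominated.nuclearSpace_of_withSeminorms
    (schwartz_withSeminorms ℝ (EuclideanSpace ℝ ι) ℂ) fun m => isNuclearlyDominated_seminorm m.1 m.2

end Euclidean

section Transfer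

variable {D : Type*} [NormedAddCommGroup D] [NormedSpace ℝ D]
variable {E : Type*} [NormedAddCommGroup E] [NormedSpace ℝ E]
variable {F : Type*} [NormedAddCommGroup F] [NormedSpace ℝ F]

/-- For finite-dimensional `F`, `𝓢(D, F)` is a finite retract of `𝓢(D, ℂ)` through a basis
`bᵢ` of `F`: `f = ∑ᵢ Re (bᵢ*(f(·)) : ℂ) • bᵢ` with continuous linear `f ↦ (bᵢ* ∘ f : ℂ)` and
`g ↦ Re g(·) • bᵢ` (`SchwartzMap.postcompCLM`); hence `𝓢(D, F)` is nuclear if `𝓢(D, ℂ)` is.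
Pietsch 1972, Props. 5.1.1, 5.2.1. [cite: Pietsch1972, Prop. 5.1.1 and Prop. 5.2.1] -/
theorem nuclearSpace_of_complex [FiniteDimensional ℝ F] [NuclearSpace ℝ 𝓢(D, ℂ)] :
    NuclearSpace ℝ 𝓢(D, F) := by
  set b := Module.finBasis ℝ F with hb
  refine NuclearSpace.of_finite_retracts (ι := Fin (Module.finrank ℝ F))
    (fun i => SchwartzMap.postcompCLM
      (Complex.ofRealCLM.comp (LinearMap.toContinuousLinearMap (b.coord i))))
    (fun i => SchwartzMap.postcompCLM (Complex.reCLM.smulRight (b i))) fun f => ?_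
  ext x
  have hsum : ∀ (g : Fin (Module.finrank ℝ F) → 𝓢(D, F)),
      (∑ i, g i) x = ∑ i, g i x := fun g => by
    induction (Finset.univ : Finset (Fin (Module.finrank ℝ F))) using Finset.induction_on with
    | empty => simp
    | insert i s hi ih => rw [Finset.sum_insert hi, Finset.sum_insert hi, add_apply, ih]
  rw [hsum]
  simp only [SchwartzMap.postcompCLM_apply, ContinuousLinearMap.smulRight_apply,
    ContinuousLinearMap.coe_comp, Function.comp_apply, LinearMap.coe_toContinuousLinearMap',
    Complex.ofRealCLM_apply, Complex.reCLM_apply, Complex.ofReal_re, Module.Basis.coord_apply]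
  exact b.sum_repr (f x)

/-- Nuclearity of `𝓢(E, F)` is transported along the linear homeomorphism
`E ≃L ℝ^{dim E}` (`toEuclidean`): `𝓢(E, F)` is a retract (indeed isomorphic image) of
`𝓢(ℝ^{dim E}, F)` via `SchwartzMap.compCLMOfContinuousLinearEquiv`. Pietsch 1972, Prop. 5.1.1.
[cite: Pietsch1972, Prop. 5.1.1] -/
theorem nuclearSpace_of_euclidean [FiniteDimensional ℝ E]
    [NuclearSpace ℝ 𝓢(EuclideanSpace ℝ (Fin (Module.finrank ℝ E)), F)] :
    NuclearSpace ℝ 𝓢(E, F) :=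
  NuclearSpace.of_retract
    (SchwartzMap.compCLMOfContinuousLinearEquiv ℝ (toEuclidean (E := E)).symm)
    (SchwartzMap.compCLMOfContinuousLinearEquiv ℝ (toEuclidean (E := E)))
    fun f => by
      ext x
      simp

end Transfer

end SchwartzNuclear

section Discharge

variable (E F : Type*) [NormedAddCommGroup E] [NormedSpace ℝ E] [NormedAddCommGroup F]
  [NormedSpace ℝ F]

/-- Discharge of the named fact `Literature.Analysis.FunctionSpaces.nuclearSpace_schwartzMap`: **the Schwartz space `𝓢(E, F)`
is nuclear** for finite-dimensional real normed spaces `E`, `F` (Pietsch's seminorm form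
`Literature.NuclearSpace ℝ`). From `SchwartzNuclear.nuclearSpace_euclidean_complex` (`𝓢(ℝ^d, ℂ)`),
`nuclearSpace_of_complex` and `nuclearSpace_of_euclidean`. Grothendieck 1955, Ch. II §2 no. 3;
Pietsch 1972, 6.2.5 (with Props. 4.1.4, 5.1.1, 5.2.1); Trèves 1967, Thm 51.5;
Gel'fand–Vilenkin IV, Ch. I §3.6. [cite: Grothendieck1955, Ch. II §2 no. 3]
[cite: Pietsch1972, 6.2.5] [cite: Treves1967, Thm 51.5] -/
theorem nuclearSpace_schwartzMap_holds : nuclearSpace_schwartzMap E F := by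
  intro _ _
  haveI : NuclearSpace ℝ 𝓢(EuclideanSpace ℝ (Fin (Module.finrank ℝ E)), ℂ) :=
    SchwartzNuclear.nuclearSpace_euclidean_complex
  haveI : NuclearSpace ℝ 𝓢(EuclideanSpace ℝ (Fin (Module.finrank ℝ E)), F) :=
    SchwartzNuclear.nuclearSpace_of_complex
  exact SchwartzNuclear.nuclearSpace_of_euclidean

end Discharge

end Literature.Analysis.FunctionSpaces
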